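import Mathlib
import HarnessLib
import Summits.KontsevichZagierPeriods.Zeta5Search.DougallNonterminating
import Literature.NumberTheory.Irrationality.Zudilin2002.WellPoisedIntegrals

/-!
# ζ(5) search — Zudilin's (9): the closed form of the very-well-poised `F₃` (Carlson range) (cell `pub-zeta5`, ct-1 g26)

HONEST FRAMING: systematic search; no irrationality claim unless kernel-certified.  An identity of special functions;
nothing here is an irrationality result; no named fact of the tree is discharged (the typed `vwp_eq_integral_of_pos` is a
statement for every `k ≥ 1`; this is the series half of its case `k = 1` on part of the parameter range).

From `DougallNonterminating.dougall_nonterminating` (brick B5f of `HOME/ct-1/g26/VWP-BLUEPRINT.md`) at the real point `z = −h₃`: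
* `zudilin_nine` — for real `h₀, h₁, h₂, h₃ > 0` with `2(h₁+h₂) < 1+h₀`, `2h₃ < 1+h₀`:
  `Σ_μ (h₀+2μ)·Γ(h₀+μ)Γ(h₁+μ)Γ(h₂+μ)Γ(h₃+μ)/(Γ(μ+1)Γ(h₀−h₁+1+μ)Γ(h₀−h₂+1+μ)Γ(h₀−h₃+1+μ))
     = Γ(h₁)Γ(h₂)Γ(h₃)Γ(h₀−h₁−h₂−h₃+1)/(Γ(h₀−h₁−h₂+1)Γ(h₀−h₁−h₃+1)Γ(h₀−h₂−h₃+1))`  (complex form with real parameters) —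
  eq. (9) of [Zudilin, math/0206177] = Dougall's theorem [cite: Bailey1935, §4.4 (1)], in that range;
* `vwpSeries_three_eq` — the same for the Literature's typed real series `Zudilin2002.vwpSeries 3 h` (`h : ℕ → ℝ`), i.e. the
  very-well-poised `F₃(h₀;h₁,h₂,h₃)` of the typed statement `vwp_eq_integral_of_pos` at `k = 1`, under the same hypotheses.
Theorems only (no new definitions).
-/

noncomputable section

namespace Summit.KontsevichZagierPeriods.Zeta5Search.DougallZudilinForm

open Finset Filter
open Summit.KontsevichZagierPeriods.Zeta5Search.HypergeometricWhipple (rf)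
open Summit.KontsevichZagierPeriods.Zeta5Search.DougallTerminatingGamma (Gamma_add_nat_eq_mul_rf rf_ne_zero)
open Summit.KontsevichZagierPeriods.Zeta5Search.DougallNonterminating (dougall_nonterminating)

/-- A positive real is not a pole of `Γ` (as a complex number). -/
theorem ne_neg_nat_of_pos {x : ℝ} (hx : 0 < x) : ∀ n : ℕ, (x : ℂ) ≠ -(n : ℂ) := by
  intro n h
  have := congrArg Complex.re h
  simp at this
  linarith [n.cast_nonneg (α := ℝ)]

/-- **Zudilin's (9) in the Carlson range** (Dougall's non-terminating `₅F₄` sum in Gamma form): for real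
`h₀, h₁, h₂, h₃ > 0` with `2(h₁+h₂) < 1+h₀` and `2h₃ < 1+h₀`,
`Σ_μ (h₀+2μ)Γ(h₀+μ)Γ(h₁+μ)Γ(h₂+μ)Γ(h₃+μ)/(Γ(μ+1)Γ(h₀−h₁+1+μ)Γ(h₀−h₂+1+μ)Γ(h₀−h₃+1+μ))
 = Γ(h₁)Γ(h₂)Γ(h₃)Γ(h₀−h₁−h₂−h₃+1)/(Γ(h₀−h₁−h₂+1)Γ(h₀−h₁−h₃+1)Γ(h₀−h₂−h₃+1))`. [cite: Bailey1935, §4.4 (1)] -/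
theorem zudilin_nine (h₀ h₁ h₂ h₃ : ℝ) (hh₀ : 0 < h₀) (hh₁ : 0 < h₁) (hh₂ : 0 < h₂) (hh₃ : 0 < h₃)
    (hsum : 2 * (h₁ + h₂) < 1 + h₀) (h3lt : 2 * h₃ < 1 + h₀) :
    ∑' μ : ℕ, ((h₀ : ℂ) + 2 * μ) *
        (Complex.Gamma ((h₀ : ℂ) + μ) * Complex.Gamma ((h₁ : ℂ) + μ) * Complex.Gamma ((h₂ : ℂ) + μ) *
          Complex.Gamma ((h₃ : ℂ) + μ)) /
        (Complex.Gamma ((μ : ℂ) + 1) * Complex.Gamma ((h₀ : ℂ) - h₁ + 1 + μ) * Complex.Gamma ((h₀ : ℂ) - h₂ + 1 + μ) *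
          Complex.Gamma ((h₀ : ℂ) - h₃ + 1 + μ)) =
      Complex.Gamma h₁ * Complex.Gamma h₂ * Complex.Gamma h₃ * Complex.Gamma ((h₀ : ℂ) - h₁ - h₂ - h₃ + 1) /
        (Complex.Gamma ((h₀ : ℂ) - h₁ - h₂ + 1) * Complex.Gamma ((h₀ : ℂ) - h₁ - h₃ + 1) *
          Complex.Gamma ((h₀ : ℂ) - h₂ - h₃ + 1)) := by
  have key := dougall_nonterminating h₀ h₁ h₂ hh₀ hh₁ hh₂ hsum (z := -(h₃ : ℂ)) (by simp; linarith)
  simp only [neg_neg] at key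
  rw [show (h₀ : ℂ) + 1 + -(h₃ : ℂ) = ((h₀ - h₃ + 1 : ℝ) : ℂ) by push_cast; ring] at key
  -- pole bookkeeping
  have H3 := ne_neg_nat_of_pos hh₃
  have HD : ∀ n : ℕ, (((h₀ - h₃ + 1 : ℝ)) : ℂ) ≠ -(n : ℂ) := ne_neg_nat_of_pos (by linarith)
  have hΓD : Complex.Gamma (((h₀ - h₃ + 1 : ℝ)) : ℂ) ≠ 0 := Complex.Gamma_ne_zero HD
  have hΓ3 : Complex.Gamma (h₃ : ℂ) ≠ 0 := Complex.Gamma_ne_zero H3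
  -- termwise: `c_μ (h₃)_μ/(h₀−h₃+1)_μ · Γ(h₃)/Γ(h₀−h₃+1) = c_μ Γ(h₃+μ)/Γ(h₀−h₃+1+μ)`
  have hterm : ∀ μ : ℕ, ((h₀ : ℂ) + 2 * μ) *
        (Complex.Gamma ((h₀ : ℂ) + μ) * Complex.Gamma ((h₁ : ℂ) + μ) * Complex.Gamma ((h₂ : ℂ) + μ) *
          Complex.Gamma ((h₃ : ℂ) + μ)) /
        (Complex.Gamma ((μ : ℂ) + 1) * Complex.Gamma ((h₀ : ℂ) - h₁ + 1 + μ) * Complex.Gamma ((h₀ : ℂ) - h₂ + 1 + μ) *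
          Complex.Gamma ((h₀ : ℂ) - h₃ + 1 + μ)) =
      (((h₀ : ℂ) + 2 * μ) *
        (Complex.Gamma ((h₀ : ℂ) + μ) * Complex.Gamma ((h₁ : ℂ) + μ) * Complex.Gamma ((h₂ : ℂ) + μ)) /
          (Complex.Gamma ((μ : ℂ) + 1) * Complex.Gamma ((h₀ : ℂ) - h₁ + 1 + μ) * Complex.Gamma ((h₀ : ℂ) - h₂ + 1 + μ)) *
        (rf (h₃ : ℂ) μ / rf (((h₀ - h₃ + 1 : ℝ)) : ℂ) μ)) *
        (Complex.Gamma (h₃ : ℂ) / Complex.Gamma (((h₀ - h₃ + 1 : ℝ)) : ℂ)) := by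
    intro μ
    have e3 : Complex.Gamma ((h₃ : ℂ) + μ) = Complex.Gamma (h₃ : ℂ) * rf (h₃ : ℂ) μ := Gamma_add_nat_eq_mul_rf H3 μ
    have eD : Complex.Gamma ((h₀ : ℂ) - h₃ + 1 + μ) = Complex.Gamma (((h₀ - h₃ + 1 : ℝ)) : ℂ) * rf (((h₀ - h₃ + 1 : ℝ)) : ℂ) μ := by
      rw [show (h₀ : ℂ) - h₃ + 1 + μ = (((h₀ - h₃ + 1 : ℝ)) : ℂ) + μ by push_cast; ring]
      exact Gamma_add_nat_eq_mul_rf HD μ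
    have hr : rf (((h₀ - h₃ + 1 : ℝ)) : ℂ) μ ≠ 0 := rf_ne_zero HD μ
    rw [e3, eD]
    field_simp
  rw [tsum_congr hterm, tsum_mul_right, key]
  have e2 : Complex.Gamma ((h₀ : ℂ) - h₁ - h₂ + 1 + -(h₃ : ℂ)) = Complex.Gamma ((h₀ : ℂ) - h₁ - h₂ - h₃ + 1) := by
    congr 1; ring
  have e4 : Complex.Gamma ((h₀ : ℂ) - h₁ + 1 + -(h₃ : ℂ)) = Complex.Gamma ((h₀ : ℂ) - h₁ - h₃ + 1) := by
    congr 1; ring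
  have e5 : Complex.Gamma ((h₀ : ℂ) - h₂ + 1 + -(h₃ : ℂ)) = Complex.Gamma ((h₀ : ℂ) - h₂ - h₃ + 1) := by
    congr 1; ring
  rw [e2, e4, e5]
  field_simp

/-- **The typed very-well-poised series `F₃` in closed form (Carlson range)**: for `h : ℕ → ℝ` with `h 0, h 1, h 2, h 3 > 0`,
`2(h 1 + h 2) < 1 + h 0` and `2·h 3 < 1 + h 0`, the Literature's `Zudilin2002.vwpSeries 3 h = F₃(h₀;h₁,h₂,h₃)` equals
`Γ(h₁)Γ(h₂)Γ(h₃)Γ(h₀−h₁−h₂−h₃+1)/(Γ(h₀−h₁−h₂+1)Γ(h₀−h₁−h₃+1)Γ(h₀−h₂−h₃+1))` — eq. (9) of Zudilin's note for the typed object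
(the series half of the case `k = 1` of `vwp_eq_integral_of_pos`, on this part of the parameter range). -/
theorem vwpSeries_three_eq (h : ℕ → ℝ) (hh₀ : 0 < h 0) (hh₁ : 0 < h 1) (hh₂ : 0 < h 2) (hh₃ : 0 < h 3)
    (hsum : 2 * (h 1 + h 2) < 1 + h 0) (h3lt : 2 * h 3 < 1 + h 0) :
    Literature.NumberTheory.Irrationality.Zudilin2002.vwpSeries 3 h =
      Real.Gamma (h 1) * Real.Gamma (h 2) * Real.Gamma (h 3) * Real.Gamma (h 0 - h 1 - h 2 - h 3 + 1) /
        (Real.Gamma (h 0 - h 1 - h 2 + 1) * Real.Gamma (h 0 - h 1 - h 3 + 1) * Real.Gamma (h 0 - h 2 - h 3 + 1)) := by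
  have key := zudilin_nine (h 0) (h 1) (h 2) (h 3) hh₀ hh₁ hh₂ hh₃ hsum h3lt
  apply Complex.ofReal_injective
  unfold Literature.NumberTheory.Irrationality.Zudilin2002.vwpSeries
  rw [Complex.ofReal_tsum]
  have hterm : ∀ μ : ℕ, (((h 0 + 2 * μ) *
        (∏ j ∈ Finset.range (3 + 1), Real.Gamma (h j + μ) / Real.Gamma (1 + h 0 - h j + μ)) *
        (-1 : ℝ) ^ ((3 + 1) * μ) : ℝ) : ℂ) =
      ((h 0 : ℂ) + 2 * μ) *
        (Complex.Gamma ((h 0 : ℂ) + μ) * Complex.Gamma ((h 1 : ℂ) + μ) * Complex.Gamma ((h 2 : ℂ) + μ) *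
          Complex.Gamma ((h 3 : ℂ) + μ)) /
        (Complex.Gamma ((μ : ℂ) + 1) * Complex.Gamma ((h 0 : ℂ) - h 1 + 1 + μ) * Complex.Gamma ((h 0 : ℂ) - h 2 + 1 + μ) *
          Complex.Gamma ((h 0 : ℂ) - h 3 + 1 + μ)) := by
    intro μ
    have hsign : (-1 : ℝ) ^ ((3 + 1) * μ) = 1 := by
      rw [show (3 + 1) * μ = 2 * (2 * μ) by ring, pow_mul, neg_one_sq, one_pow]
    rw [hsign, mul_one]
    simp only [Finset.prod_range_succ, Finset.prod_range_zero, one_mul]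
    push_cast
    simp only [← Complex.Gamma_ofReal]
    push_cast
    rw [show (1 : ℂ) + (h 0 : ℂ) - (h 0 : ℂ) + (μ : ℂ) = (μ : ℂ) + 1 by ring,
      show (1 : ℂ) + (h 0 : ℂ) - (h 1 : ℂ) + (μ : ℂ) = (h 0 : ℂ) - h 1 + 1 + μ by ring,
      show (1 : ℂ) + (h 0 : ℂ) - (h 2 : ℂ) + (μ : ℂ) = (h 0 : ℂ) - h 2 + 1 + μ by ring,
      show (1 : ℂ) + (h 0 : ℂ) - (h 3 : ℂ) + (μ : ℂ) = (h 0 : ℂ) - h 3 + 1 + μ by ring]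
    ring
  rw [tsum_congr hterm, key]
  push_cast
  simp only [← Complex.Gamma_ofReal]
  push_cast
  ring_nf

end Summit.KontsevichZagierPeriods.Zeta5Search.DougallZudilinForm

end
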